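import Literature.NumberTheory.Sieve.BombieriFriedlanderIwaniecTheorem9
import Literature.NumberTheory.Sieve.BombieriFriedlanderIwaniecLemma6
import Literature.NumberTheory.Sieve.RoughNumbersCoprimeProgressions
import HarnessLib

/-!
# Bombieri–Friedlander–Iwaniec 1986, Theorem 7* (§14): the elementary steps of the printed proof

Topic `Literature/NumberTheory/Sieve`, companion to
`Literature.NumberTheory.Sieve.BombieriFriedlanderIwaniecTheorem9`, which vendors **Theorem 7*** of
E. Bombieri, J. B. Friedlander, H. Iwaniec, *Primes in arithmetic progressions to large moduli*,
Acta Math. 156 (1986), 203–251 (§14, p. 246) as the named fact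
`Literature.NumberTheory.Sieve.BombieriFriedlanderIwaniecTheorem7Star` (the sums `Δ*(M, N, L, Q, R)`,
`Literature.NumberTheory.Sieve.BFI.deltaStar`).  Everything here is PROVED; no named fact is
introduced.

The printed proof of Theorem 7 / 7* (pp. 244–246) runs: smoothing `Δ → Δ₀`; Lemma 2 (Poisson) in
the smooth variable `m`, (14.2)–(14.3); reciprocity and separation of variables; Lemma 1
(= Deshouillers–Iwaniec, Invent. Math. 70 (1982), Thm 12 — neither in Mathlib nor in the tree) under
the auxiliary conditions (14.4) `N < x^ε QR`, `Q²R < x`; the numerics giving `Δ₀ ≪ x^{1−ε}` from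
(14.5)–(14.6); removal of (14.4) ("we assume that `N < M` … because otherwise the result follows from
(1.5)" and "`Q²R < x` can be removed as in Theorem 6"); and finally the extension to `z`-rough
variables by the fundamental lemma (Lemma 4) "as in Section 12".  This file formalises the
elementary, unconditional parts of that chain, in the order of the paper:

* `BFI.deltaStar_comm` — `Δ*(M, N, L, Q, R) = Δ*(N, M, L, Q, R)` (the two smooth variables play
  symmetric roles; this is the "we assume that `N < M`" of p. 246), and the corresponding reduction of
  the named fact to the ordered case `N ≤ M`
  (`BombieriFriedlanderIwaniecTheorem7Star.of_ordered`).
* `BFI.abs_roughDisc_le_of_le_two` — for unsieved variables (`z ≤ 2`), a modulus `d` with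
  `(d, a) = 1` and `(l, d) = 1`, the bracket of `Δ` at `(l, d)` is `≤ ⌊M⌋ (1 + τ(d)/φ(d))` in absolute
  value: for each `m` coprime to `d` the `n ≤ N` with `lmn ≡ a (d)` form ONE residue class, counted
  with error `≤ 1` against `⌊N⌋/d`, and `#{n ≤ N : (n, d) = 1} = φ(d)⌊N⌋/d + O(τ(d))`.
* `BFI.deltaStar_le_of_le_two`, `BFI.deltaStar_trivial_bound`, `BFI.deltaStar_trivial_regime` —
  hence the TRIVIAL BOUND `Δ(M, N, L, Q, R) ≤ ⌊L⌋⌊M⌋ ∑_{r ≤ R} ∑_{q ≤ Q} (1 + τ(qr)/φ(qr))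
  ≪ L M (QR + log⁸Q log⁸R)`, i.e. `Δ ≪ x^{1−ε} log¹⁶ x` as soon as the smooth variable `n` is longer
  than `x^ε QR` — the case `N ≥ x^ε QR` excluded by (14.4), which the print dismisses in one clause
  (p. 246).
* `BFI.section14_H_le`, `BFI.lemma1I_sq_le_section14`, `BFI.section14_final_numerics`,
  `BFI.section14_main_identity`, `BFI.section14_step5` — the numerics of p. 246: under (14.4)
  (`N < x^ε QR`, `Q²R < x`) one has `H < x^ε LR` and
  `𝓘(N, Q, a²H, R, |a|L)² ≪ x^ε QRLN(LR + NL^{1/2})` for the quantity `𝓘` of Lemma 1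
  (`BFI.lemma1I` of `…Lemma6`), and (14.5)–(14.6) turn
  `M(QR)⁻¹ 𝓘 (HLR)^{1/2}` into `≪ x^{1−ε/2+O(ε')}` — real inequalities with the floating powers
  `x^ε` carried as parameters `T, U ≥ 1`.
* `BFI.roughBracket_eq_sum_n`, `BFI.deltaStar_le_sum_deltaStar_one` — the bracket of `Δ*`
  decomposes over the variable `n`, and a (short) rough `n` can be merged into `l`:
  `Δ*(M, N, L, Q, R) ≤ ∑_{n ≤ N} 1_{(n,P(z))=1} Δ*(M, 1, Ln, Q, R)` (preparing the sieve extension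
  `Δ → Δ*`, where only long variables can be sieved with an admissible remainder).
* `BombieriFriedlanderIwaniecTheorem7Star.bound_nonneg` — cosmetic normalisation of the constants of
  the named fact (`B, C ≥ 0`, `x₀ ≥ 3`).

Not here (the deep or long parts, see the module docstring of the companion file and BFI §14): the
dispersion/Poisson/Lemma 1 core ((14.2)–(14.3) and the application of Lemma 1 =
Deshouillers–Iwaniec), the `q ↔ s` switch removing `Q²R < x`, and the two-variable
fundamental-lemma extension `Δ → Δ*` itself.

## References

* E. Bombieri, J. B. Friedlander, H. Iwaniec, *Primes in arithmetic progressions to large moduli*,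
  Acta Math. 156 (1986), 203–251: §14 pp. 244–246 (the sums `Δ`, (14.1)–(14.6), Theorems 7, 7*).
  [BombieriFriedlanderIwaniecActa1986]
-/

open Finset Real
open scoped ArithmeticFunction.sigma

namespace Literature.NumberTheory.Sieve

namespace BFI

/-! ### Symmetry in the two smooth variables (p. 246: "we assume that `N < M`") -/

/-- The congruence count of §14 is symmetric in the two smooth variables `m ≤ M`, `n ≤ N`.
[folklore] -/
theorem roughCongrCount_comm (a : ℤ) (z M N : ℝ) (l d : ℕ) :
    roughCongrCount a z M N l d = roughCongrCount a z N M l d := by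
  unfold roughCongrCount
  rw [Finset.sum_comm]
  refine Finset.sum_congr rfl fun n _ => Finset.sum_congr rfl fun m _ => ?_
  rw [mul_right_comm l m n, mul_comm (roughIndicator z m) (roughIndicator z n)]

/-- The coprimality count of §14 is symmetric in `m ≤ M`, `n ≤ N`. [folklore] -/
theorem roughCoprimeCount_comm (z M N : ℝ) (d : ℕ) :
    roughCoprimeCount z M N d = roughCoprimeCount z N M d := by
  unfold roughCoprimeCount
  rw [Finset.sum_comm]
  refine Finset.sum_congr rfl fun n _ => Finset.sum_congr rfl fun m _ => ?_
  rw [mul_comm m n, mul_comm (roughIndicator z m) (roughIndicator z n)]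

/-- **`Δ*(M, N, L, Q, R) = Δ*(N, M, L, Q, R)`**: the sums of BFI §14 are symmetric in the two smooth
(`z`-rough) variables, so that one may assume `N ≤ M` (p. 246, "we assume that `N < M`").
[cite: BombieriFriedlanderIwaniecActa1986, §14 p. 246] -/
theorem deltaStar_comm (a : ℤ) (z M N L Q R : ℝ) :
    deltaStar a z M N L Q R = deltaStar a z N M L Q R := by
  unfold deltaStar
  refine Finset.sum_congr rfl fun r _ => Finset.sum_congr rfl fun l _ => ?_
  congr 1
  congr 1
  exact Finset.sum_congr rfl fun q _ => by rw [roughCongrCount_comm, roughCoprimeCount_comm]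

/-! ### The brackets of `Δ` for unsieved variables (`z ≤ 2`) -/

/-- For `z ≤ 2` (no sieving) the congruence count is `∑_{m ≤ M} #{n ≤ N : lmn ≡ a (mod d)}`.
[folklore] -/
theorem roughCongrCount_of_le_two {z : ℝ} (hz : z ≤ 2) (a : ℤ) (M N : ℝ) (l d : ℕ) :
    roughCongrCount a z M N l d =
      ∑ m ∈ Icc 1 ⌊M⌋₊,
        (#((Icc 1 ⌊N⌋₊).filter fun n : ℕ => ((l * m * n : ℕ) : ZMod d) = (a : ZMod d)) : ℝ) := by
  unfold roughCongrCount
  refine Finset.sum_congr rfl fun m _ => ?_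
  rw [Finset.card_eq_sum_ones, Nat.cast_sum, Finset.sum_filter]
  push_cast
  refine Finset.sum_congr rfl fun n _ => ?_
  rw [roughIndicator_of_le_two hz m, roughIndicator_of_le_two hz n, mul_one]

/-- For `z ≤ 2` the coprimality count is `∑_{m ≤ M, (m,d)=1} #{n ≤ N : (n, d) = 1}`. [folklore] -/
theorem roughCoprimeCount_of_le_two {z : ℝ} (hz : z ≤ 2) (M N : ℝ) (d : ℕ) :
    roughCoprimeCount z M N d =
      ∑ m ∈ Icc 1 ⌊M⌋₊,
        if m.Coprime d then (#((Icc 1 ⌊N⌋₊).filter fun n : ℕ => n.Coprime d) : ℝ) else 0 := by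
  unfold roughCoprimeCount
  refine Finset.sum_congr rfl fun m _ => ?_
  by_cases hm : m.Coprime d
  · rw [if_pos hm, Finset.card_eq_sum_ones, Nat.cast_sum, Finset.sum_filter]
    push_cast
    refine Finset.sum_congr rfl fun n _ => ?_
    rw [roughIndicator_of_le_two hz m, roughIndicator_of_le_two hz n, mul_one]
    by_cases hn : n.Coprime d
    · rw [if_pos (Nat.Coprime.mul_left hm hn), if_pos hn]
    · rw [if_neg hn, if_neg (fun h => hn (Nat.Coprime.coprime_mul_left h))]
  · rw [if_neg hm]
    refine Finset.sum_eq_zero fun n _ => ?_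
    rw [if_neg (fun h => hm (Nat.Coprime.coprime_mul_right h))]

/-- **One class, error at most one.**  If `(lm, d) = 1` then the `n ≤ N'` with `lmn ≡ a (mod d)`
form the single class `n ≡ a (lm)⁻¹`, so their number differs from `N'/d` by at most `1`. [folklore] -/
theorem abs_card_congr_sub_div_le {d : ℕ} (hd : 0 < d) (a : ℤ) {l m : ℕ} (hlm : (l * m).Coprime d)
    (N' : ℕ) :
    |(#((Icc 1 N').filter fun n : ℕ => ((l * m * n : ℕ) : ZMod d) = (a : ZMod d)) : ℝ) -
        (N' : ℝ) / d| ≤ 1 := by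
  haveI : NeZero d := ⟨hd.ne'⟩
  set u : ZMod d := ((l * m : ℕ) : ZMod d) with hu
  have hu1 : u * u⁻¹ = 1 := ZMod.coe_mul_inv_eq_one _ hlm
  set c : ZMod d := (a : ZMod d) * u⁻¹ with hc
  have hiff : ∀ n : ℕ, ((l * m * n : ℕ) : ZMod d) = (a : ZMod d) ↔ n ≡ c.val [MOD d] := by
    intro n
    rw [← ZMod.natCast_eq_natCast_iff, ZMod.natCast_zmod_val, Nat.cast_mul, ← hu]
    constructor
    · intro h
      linear_combination u⁻¹ * h - (n : ZMod d) * hu1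
    · intro h
      linear_combination u * h + (a : ZMod d) * hu1
  have hset : ((Icc 1 N').filter fun n : ℕ => ((l * m * n : ℕ) : ZMod d) = (a : ZMod d)) =
      (Ioc 0 N').filter fun n : ℕ => n ≡ c.val [MOD d] := by
    rw [show Icc 1 N' = Ioc 0 N' from Finset.Icc_succ_left_eq_Ioc 0 N']
    exact Finset.filter_congr fun n _ => hiff n
  rw [hset]
  have h := abs_card_Ioc_filter_modEq_sub_le hd c.val (Nat.zero_le N')
  simpa using h

/-- **The bracket of `Δ` is `O(M)` for unsieved variables.**  Let `z ≤ 2`, `d ≥ 1` with `(d, a) = 1`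
and `(l, d) = 1`.  Then
`|#{m ≤ M, n ≤ N : lmn ≡ a (d)} − φ(d)⁻¹ #{m ≤ M, n ≤ N : (mn, d) = 1}| ≤ ⌊M⌋ (1 + τ(d)/φ(d))`:
for `(m, d) > 1` both counts vanish, and for `(m, d) = 1` the congruence count is `⌊N⌋/d + O(1)`
(`abs_card_congr_sub_div_le`) while `#{n ≤ N : (n,d)=1} = φ(d)⌊N⌋/d + O(τ(d))`
(`BFI.abs_card_coprime_sub_le`).  This is the trivial estimation behind "otherwise the result follows
from (1.5)" on p. 246 of the source. [cite: BombieriFriedlanderIwaniecActa1986, §14 p. 246] -/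
theorem abs_roughDisc_le_of_le_two {z : ℝ} (hz : z ≤ 2) {a : ℤ} (M N : ℝ) {l d : ℕ} (hd : 0 < d)
    (hda : IsCoprime (d : ℤ) a) (hl : l.Coprime d) :
    |roughCongrCount a z M N l d - roughCoprimeCount z M N d / (Nat.totient d : ℝ)| ≤
      ⌊M⌋₊ * (1 + (σ 0 d : ℝ) / (Nat.totient d : ℝ)) := by
  have hφ : (0 : ℝ) < (Nat.totient d : ℝ) := by exact_mod_cast Nat.totient_pos.2 hd
  have hdR : (0 : ℝ) < d := by exact_mod_cast hd
  rw [roughCongrCount_of_le_two hz, roughCoprimeCount_of_le_two hz, Finset.sum_div,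
    ← Finset.sum_sub_distrib]
  refine (Finset.abs_sum_le_sum_abs _ _).trans ?_
  have hterm : ∀ m ∈ Icc 1 ⌊M⌋₊,
      |(#((Icc 1 ⌊N⌋₊).filter fun n : ℕ => ((l * m * n : ℕ) : ZMod d) = (a : ZMod d)) : ℝ) -
          (if m.Coprime d then (#((Icc 1 ⌊N⌋₊).filter fun n : ℕ => n.Coprime d) : ℝ) else 0) /
            (Nat.totient d : ℝ)| ≤
        1 + (σ 0 d : ℝ) / (Nat.totient d : ℝ) := by
    intro m _
    by_cases hm : m.Coprime d
    · rw [if_pos hm]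
      have hlm : (l * m).Coprime d := Nat.Coprime.mul_left hl hm
      have h1 := abs_card_congr_sub_div_le hd a hlm ⌊N⌋₊
      have h2 := abs_card_coprime_sub_le hd.ne' 0 ⌊N⌋₊ (Nat.zero_le _)
      rw [show Icc 1 ⌊N⌋₊ = Ioc 0 ⌊N⌋₊ from Finset.Icc_succ_left_eq_Ioc 0 ⌊N⌋₊] at h1 ⊢
      simp only [Nat.cast_zero, sub_zero] at h2
      -- `|#cop/φ − ⌊N⌋/d| ≤ τ(d)/φ(d)`
      have h2' : |(#((Ioc 0 ⌊N⌋₊).filter fun n : ℕ => n.Coprime d) : ℝ) / (Nat.totient d : ℝ) -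
          (⌊N⌋₊ : ℝ) / d| ≤ (σ 0 d : ℝ) / (Nat.totient d : ℝ) := by
        have : (#((Ioc 0 ⌊N⌋₊).filter fun n : ℕ => n.Coprime d) : ℝ) / (Nat.totient d : ℝ) -
            (⌊N⌋₊ : ℝ) / d =
            ((#((Ioc 0 ⌊N⌋₊).filter fun n : ℕ => n.Coprime d) : ℝ) -
              (Nat.totient d : ℝ) / d * (⌊N⌋₊ : ℝ)) / (Nat.totient d : ℝ) := by
          field_simp
        rw [this, abs_div, abs_of_pos hφ]
        exact div_le_div_of_nonneg_right h2 hφ.le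
      calc _ ≤ |(#((Ioc 0 ⌊N⌋₊).filter fun n : ℕ => ((l * m * n : ℕ) : ZMod d) = (a : ZMod d)) : ℝ) -
                (⌊N⌋₊ : ℝ) / d| +
              |(⌊N⌋₊ : ℝ) / d -
                (#((Ioc 0 ⌊N⌋₊).filter fun n : ℕ => n.Coprime d) : ℝ) / (Nat.totient d : ℝ)| :=
            abs_sub_le _ _ _
        _ ≤ 1 + (σ 0 d : ℝ) / (Nat.totient d : ℝ) := by
            rw [abs_sub_comm ((⌊N⌋₊ : ℝ) / d)]
            exact add_le_add h1 h2'
    · rw [if_neg hm, zero_div, sub_zero]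
      have h0 : ((Icc 1 ⌊N⌋₊).filter fun n : ℕ => ((l * m * n : ℕ) : ZMod d) = (a : ZMod d)) = ∅ := by
        refine Finset.filter_eq_empty_iff.2 fun n _ h => hm ?_
        have hc : d.Coprime (l * m) := coprime_of_natCast_mul_eq hda (m := l * m) (n := n) h
        exact (Nat.Coprime.coprime_mul_left_right hc).symm
      rw [h0, Finset.card_empty, Nat.cast_zero, abs_zero]
      positivity
  refine (Finset.sum_le_sum hterm).trans ?_
  rw [Finset.sum_const, Nat.card_Icc, nsmul_eq_mul]
  norm_num

/-! ### The trivial bound for `Δ` and the case `N ≥ x^ε QR` of (14.4) -/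

/-- **Trivial bound for the sums `Δ` of §14** (unsieved variables, `z ≤ 2`):
`Δ(M, N, L, Q, R) ≤ ⌊L⌋ ⌊M⌋ ∑_{r ≤ R} ∑_{q ≤ Q} (1 + τ(qr)/φ(qr))`.  (In the ranges of `Δ` one has
`(r, a) = 1`, `(l, r) = 1`, `(q, al) = 1`, so every modulus `qr` is coprime to `a` and to `l` and
`abs_roughDisc_le_of_le_two` applies termwise.) [cite: BombieriFriedlanderIwaniecActa1986, §14 p. 246] -/
theorem deltaStar_le_of_le_two {z : ℝ} (hz : z ≤ 2) (a : ℤ) (M N L Q R : ℝ) :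
    deltaStar a z M N L Q R ≤
      ⌊L⌋₊ * ⌊M⌋₊ * ∑ r ∈ Icc 1 ⌊R⌋₊, ∑ q ∈ Icc 1 ⌊Q⌋₊,
        (1 + (σ 0 (q * r) : ℝ) / (Nat.totient (q * r) : ℝ)) := by
  unfold deltaStar
  -- the inner `q`-sum of the bound, a nonnegative function of `r`
  set S : ℕ → ℝ := fun r =>
    ∑ q ∈ Icc 1 ⌊Q⌋₊, (⌊M⌋₊ : ℝ) * (1 + (σ 0 (q * r) : ℝ) / (Nat.totient (q * r) : ℝ)) with hS
  have hS0 : ∀ r, 0 ≤ S r := fun r => Finset.sum_nonneg fun q _ => by positivity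
  -- termwise bound, then drop the filters
  have hin : ∀ r ∈ (Icc 1 ⌊R⌋₊).filter (fun r : ℕ => IsCoprime (r : ℤ) a),
      ∀ l ∈ (Icc 1 ⌊L⌋₊).filter (fun l : ℕ => l.Coprime r),
        roughIndicator z l *
          |∑ q ∈ (Icc 1 ⌊Q⌋₊).filter (fun q : ℕ => IsCoprime (q : ℤ) (a * l)),
            (roughCongrCount a z M N l (q * r) -
              roughCoprimeCount z M N (q * r) / (Nat.totient (q * r) : ℝ))| ≤ S r := by
    intro r hr l hl
    rw [Finset.mem_filter, Finset.mem_Icc] at hr hl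
    rw [roughIndicator_of_le_two hz l, one_mul, hS]
    refine (Finset.abs_sum_le_sum_abs _ _).trans ?_
    refine (Finset.sum_le_sum fun q hq => ?_).trans
      (Finset.sum_le_sum_of_subset_of_nonneg (Finset.filter_subset _ _) fun q _ _ => by positivity)
    rw [Finset.mem_filter, Finset.mem_Icc] at hq
    have hq1 : 0 < q := hq.1.1
    have hr1 : 0 < r := hr.1.1
    have hqa : IsCoprime (q : ℤ) a := hq.2.of_mul_right_left
    have hql : q.Coprime l := Nat.isCoprime_iff_coprime.mp hq.2.of_mul_right_right
    have hda : IsCoprime ((q * r : ℕ) : ℤ) a := by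
      push_cast
      exact IsCoprime.mul_left hqa hr.2
    have hl' : l.Coprime (q * r) := Nat.Coprime.mul_right hql.symm hl.2
    exact abs_roughDisc_le_of_le_two hz M N (Nat.mul_pos hq1 hr1) hda hl'
  have hdropL : ∀ r : ℕ, ∑ _l ∈ (Icc 1 ⌊L⌋₊).filter (fun l : ℕ => l.Coprime r), S r ≤
      ∑ _l ∈ Icc 1 ⌊L⌋₊, S r := fun r =>
    Finset.sum_le_sum_of_subset_of_nonneg (Finset.filter_subset _ _) fun l _ _ => hS0 r
  calc _ ≤ ∑ r ∈ (Icc 1 ⌊R⌋₊).filter (fun r : ℕ => IsCoprime (r : ℤ) a),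
          ∑ _l ∈ (Icc 1 ⌊L⌋₊).filter (fun l : ℕ => l.Coprime r), S r :=
        Finset.sum_le_sum fun r hr => Finset.sum_le_sum fun l hl => hin r hr l hl
    _ ≤ ∑ r ∈ (Icc 1 ⌊R⌋₊).filter (fun r : ℕ => IsCoprime (r : ℤ) a),
          ∑ _l ∈ Icc 1 ⌊L⌋₊, S r := Finset.sum_le_sum fun r _ => hdropL r
    _ ≤ ∑ r ∈ Icc 1 ⌊R⌋₊, ∑ _l ∈ Icc 1 ⌊L⌋₊, S r :=
        Finset.sum_le_sum_of_subset_of_nonneg (Finset.filter_subset _ _) fun r _ _ =>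
          Finset.sum_nonneg fun l _ => hS0 r
    _ = _ := by
        simp only [hS]
        rw [Finset.mul_sum]
        refine Finset.sum_congr rfl fun r _ => ?_
        rw [Finset.sum_const, Nat.card_Icc, nsmul_eq_mul, Finset.mul_sum, Finset.mul_sum]
        refine Finset.sum_congr rfl fun q _ => ?_
        push_cast
        ring

/-- `∑_{r ≤ R} ∑_{q ≤ Q} τ(qr)/φ(qr) ≤ (∑_{q ≤ Q} τ(q)²/q)(∑_{r ≤ R} τ(r)²/r)`, by `τ(qr) ≤ τ(q)τ(r)`,
`1/φ(k) ≤ τ(k)/k`. [folklore] -/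
theorem sum_sum_sigma_div_totient_le (Q' R' : ℕ) :
    ∑ r ∈ Icc 1 R', ∑ q ∈ Icc 1 Q', (σ 0 (q * r) : ℝ) / (Nat.totient (q * r) : ℝ) ≤
      (∑ q ∈ Icc 1 Q', (σ 0 q : ℝ) ^ 2 / q) * (∑ r ∈ Icc 1 R', (σ 0 r : ℝ) ^ 2 / r) := by
  rw [mul_comm, Finset.sum_mul]
  refine Finset.sum_le_sum fun r hr => ?_
  rw [Finset.mul_sum]
  refine Finset.sum_le_sum fun q hq => ?_
  rw [Finset.mem_Icc] at hr hq
  have hq0 : (0 : ℝ) < q := by exact_mod_cast hq.1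
  have hr0 : (0 : ℝ) < r := by exact_mod_cast hr.1
  have hτ : (σ 0 (q * r) : ℝ) ≤ (σ 0 q : ℝ) * (σ 0 r : ℝ) := by exact_mod_cast sigma_zero_mul_le q r
  have hφ : ((Nat.totient (q * r) : ℝ))⁻¹ ≤ (σ 0 (q * r) : ℝ) / (q * r : ℕ) :=
    inv_totient_le_sigma_zero_div (q * r)
  have hτ0 : (0 : ℝ) ≤ (σ 0 (q * r) : ℝ) := Nat.cast_nonneg _
  calc (σ 0 (q * r) : ℝ) / (Nat.totient (q * r) : ℝ)
      = (σ 0 (q * r) : ℝ) * ((Nat.totient (q * r) : ℝ))⁻¹ := div_eq_mul_inv _ _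
    _ ≤ ((σ 0 q : ℝ) * (σ 0 r : ℝ)) * (((σ 0 q : ℝ) * (σ 0 r : ℝ)) / (q * r : ℕ)) := by
        refine mul_le_mul hτ (hφ.trans ?_) (inv_nonneg.2 (Nat.cast_nonneg _)) (by positivity)
        exact div_le_div_of_nonneg_right hτ (Nat.cast_nonneg _)
    _ = (σ 0 r : ℝ) ^ 2 / r * ((σ 0 q : ℝ) ^ 2 / q) := by
        have hq0' : (q : ℝ) ≠ 0 := hq0.ne'
        have hr0' : (r : ℝ) ≠ 0 := hr0.ne'
        push_cast
        field_simp

/-- **The trivial bound in closed form.**  There is an absolute `C > 0` with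
`Δ(M, N, L, Q, R) ≤ L M (QR + C (1 + log Q)⁸ (1 + log R)⁸)` for `z ≤ 2`, `M, L ≥ 0`, `Q, R ≥ 1`
(any `a`, any `N`).  By `deltaStar_comm` the same holds with `M` replaced by `N`.
[cite: BombieriFriedlanderIwaniecActa1986, §14 p. 246] -/
theorem deltaStar_trivial_bound :
    ∃ C : ℝ, 0 < C ∧ ∀ z : ℝ, z ≤ 2 → ∀ a : ℤ, ∀ M N L Q R : ℝ, 0 ≤ M → 0 ≤ L → 1 ≤ Q → 1 ≤ R →
      deltaStar a z M N L Q R ≤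
        L * M * (Q * R + C * (1 + Real.log Q) ^ 8 * (1 + Real.log R) ^ 8) := by
  obtain ⟨C₁, hC₁, h₁⟩ := exists_sum_sigma_zero_pow_div_le_real 2
  refine ⟨C₁ ^ 2, by positivity, fun z hz a M N L Q R hM hL hQ hR => ?_⟩
  -- the divisor sums at `max Y 2`
  have hdiv : ∀ Y : ℝ, 1 ≤ Y → ∑ n ∈ Icc 1 ⌊Y⌋₊, (σ 0 n : ℝ) ^ 2 / n ≤ C₁ * (1 + Real.log Y) ^ 8 := by
    intro Y hY
    have hY2 : (2 : ℝ) ≤ max Y 2 := le_max_right _ _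
    have hsub : Icc 1 ⌊Y⌋₊ ⊆ Icc 1 ⌊max Y 2⌋₊ :=
      Finset.Icc_subset_Icc_right (Nat.floor_mono (le_max_left _ _))
    have hlog : Real.log (max Y 2) ≤ 1 + Real.log Y := by
      rcases le_total Y 2 with h | h
      · rw [max_eq_right h]
        have : Real.log 2 ≤ 1 := by
          have := Real.log_two_lt_d9; norm_num at this; linarith
        linarith [Real.log_nonneg hY]
      · rw [max_eq_left h]; linarith
    have hlog0 : 0 ≤ Real.log (max Y 2) := Real.log_nonneg (by linarith)
    calc ∑ n ∈ Icc 1 ⌊Y⌋₊, (σ 0 n : ℝ) ^ 2 / n ≤ ∑ n ∈ Icc 1 ⌊max Y 2⌋₊, (σ 0 n : ℝ) ^ 2 / n :=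
          Finset.sum_le_sum_of_subset_of_nonneg hsub fun n _ _ => by positivity
      _ ≤ C₁ * Real.log (max Y 2) ^ (2 ^ (2 + 1)) := h₁ _ hY2
      _ ≤ C₁ * (1 + Real.log Y) ^ 8 := by
          norm_num
          exact mul_le_mul_of_nonneg_left (pow_le_pow_left₀ hlog0 hlog 8) hC₁.le
  have hQ' : (⌊Q⌋₊ : ℝ) ≤ Q := Nat.floor_le (by linarith)
  have hR' : (⌊R⌋₊ : ℝ) ≤ R := Nat.floor_le (by linarith)
  have hL' : (⌊L⌋₊ : ℝ) ≤ L := Nat.floor_le hL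
  have hM' : (⌊M⌋₊ : ℝ) ≤ M := Nat.floor_le hM
  have hlogQ : 0 ≤ Real.log Q := Real.log_nonneg hQ
  have hlogR : 0 ≤ Real.log R := Real.log_nonneg hR
  have hsum : ∑ r ∈ Icc 1 ⌊R⌋₊, ∑ q ∈ Icc 1 ⌊Q⌋₊,
      (1 + (σ 0 (q * r) : ℝ) / (Nat.totient (q * r) : ℝ)) ≤
      Q * R + C₁ ^ 2 * (1 + Real.log Q) ^ 8 * (1 + Real.log R) ^ 8 := by
    have hsplit : ∑ r ∈ Icc 1 ⌊R⌋₊, ∑ q ∈ Icc 1 ⌊Q⌋₊,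
        (1 + (σ 0 (q * r) : ℝ) / (Nat.totient (q * r) : ℝ)) =
        (⌊R⌋₊ : ℝ) * ⌊Q⌋₊ +
          ∑ r ∈ Icc 1 ⌊R⌋₊, ∑ q ∈ Icc 1 ⌊Q⌋₊, (σ 0 (q * r) : ℝ) / (Nat.totient (q * r) : ℝ) := by
      simp only [Finset.sum_add_distrib, Finset.sum_const, Nat.card_Icc, nsmul_eq_mul,
        Nat.add_sub_cancel, mul_one]
    rw [hsplit]
    have hRQ : (⌊R⌋₊ : ℝ) * ⌊Q⌋₊ ≤ Q * R := by
      rw [mul_comm Q R]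
      exact mul_le_mul hR' hQ' (Nat.cast_nonneg _) (by linarith)
    refine add_le_add hRQ ?_
    refine (sum_sum_sigma_div_totient_le ⌊Q⌋₊ ⌊R⌋₊).trans ?_
    have h1 := hdiv Q hQ
    have h2 := hdiv R hR
    have h0 : 0 ≤ ∑ r ∈ Icc 1 ⌊R⌋₊, (σ 0 r : ℝ) ^ 2 / r :=
      Finset.sum_nonneg fun r _ => by positivity
    calc (∑ q ∈ Icc 1 ⌊Q⌋₊, (σ 0 q : ℝ) ^ 2 / q) * (∑ r ∈ Icc 1 ⌊R⌋₊, (σ 0 r : ℝ) ^ 2 / r)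
        ≤ (C₁ * (1 + Real.log Q) ^ 8) * (C₁ * (1 + Real.log R) ^ 8) :=
          mul_le_mul h1 h2 h0 (by positivity)
      _ = C₁ ^ 2 * (1 + Real.log Q) ^ 8 * (1 + Real.log R) ^ 8 := by ring
  have hS0 : 0 ≤ ∑ r ∈ Icc 1 ⌊R⌋₊, ∑ q ∈ Icc 1 ⌊Q⌋₊,
      (1 + (σ 0 (q * r) : ℝ) / (Nat.totient (q * r) : ℝ)) :=
    Finset.sum_nonneg fun r _ => Finset.sum_nonneg fun q _ => by positivity
  calc deltaStar a z M N L Q R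
      ≤ ⌊L⌋₊ * ⌊M⌋₊ * ∑ r ∈ Icc 1 ⌊R⌋₊, ∑ q ∈ Icc 1 ⌊Q⌋₊,
          (1 + (σ 0 (q * r) : ℝ) / (Nat.totient (q * r) : ℝ)) := deltaStar_le_of_le_two hz a M N L Q R
    _ ≤ L * M * (Q * R + C₁ ^ 2 * (1 + Real.log Q) ^ 8 * (1 + Real.log R) ^ 8) := by
        refine mul_le_mul (mul_le_mul hL' hM' (Nat.cast_nonneg _) hL) hsum hS0 (by positivity)

/-- **The case `N ≥ x^ε QR` of Theorem 7** (p. 246: (14.4) requires `N < x^ε QR`, "because otherwise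
the result follows from (1.5)" — in fact trivially): there is an absolute `C > 0` such that for
`z ≤ 2`, `x ≥ 1`, `M ≥ 0`, `L ≥ 0`, `1 ≤ Q ≤ x`, `1 ≤ R ≤ x`, `N > 0`, `LMN = x` and `x^ε QR ≤ N`:
`Δ(M, N, L, Q, R) ≤ C x^{1−ε} (1 + log x)¹⁶`.  (By `deltaStar_comm` the same holds with the roles of
`M` and `N` exchanged.) [cite: BombieriFriedlanderIwaniecActa1986, §14 (14.4) and p. 246] -/
theorem deltaStar_trivial_regime :
    ∃ C : ℝ, 0 < C ∧ ∀ z : ℝ, z ≤ 2 → ∀ a : ℤ, ∀ ε x M N L Q R : ℝ,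
      1 ≤ x → 0 ≤ M → 0 ≤ L → 1 ≤ Q → Q ≤ x → 1 ≤ R → R ≤ x → 0 < N → L * M * N = x →
      x ^ ε * (Q * R) ≤ N →
        deltaStar a z M N L Q R ≤ C * x ^ (1 - ε) * (1 + Real.log x) ^ 16 := by
  obtain ⟨C, hC, h⟩ := deltaStar_trivial_bound
  refine ⟨1 + C, by positivity, fun z hz a ε x M N L Q R hx hM hL hQ hQx hR hRx hN hLMN hNε => ?_⟩
  have hx0 : 0 < x := by linarith
  have hQR : 1 ≤ Q * R := one_le_mul_of_one_le_of_one_le hQ hR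
  have hQR0 : 0 < Q * R := by positivity
  have hxe : 0 < x ^ ε := Real.rpow_pos_of_pos hx0 ε
  have hlogx : 0 ≤ Real.log x := Real.log_nonneg hx
  have hlogQ : Real.log Q ≤ Real.log x := Real.log_le_log (by linarith) hQx
  have hlogR : Real.log R ≤ Real.log x := Real.log_le_log (by linarith) hRx
  have hlogQ0 : 0 ≤ Real.log Q := Real.log_nonneg hQ
  have hlogR0 : 0 ≤ Real.log R := Real.log_nonneg hR
  -- `L M = x / N ≤ x^{1-ε} / (QR)`
  have hLM : L * M = x / N := by
    rw [eq_div_iff hN.ne']; linarith [hLMN]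
  have hsplit : x ^ (1 - ε) = x / x ^ ε := by
    rw [Real.rpow_sub hx0, Real.rpow_one]
  have hLM' : L * M ≤ x ^ (1 - ε) / (Q * R) := by
    rw [hLM, hsplit, div_div, div_le_div_iff_of_pos_left hx0 hN (by positivity)]
    exact hNε
  have hlogs : (1 + Real.log Q) ^ 8 * (1 + Real.log R) ^ 8 ≤ (1 + Real.log x) ^ 16 := by
    rw [show (16 : ℕ) = 8 + 8 from rfl, pow_add]
    exact mul_le_mul (pow_le_pow_left₀ (by linarith) (by linarith) 8)
      (pow_le_pow_left₀ (by linarith) (by linarith) 8) (by positivity) (by positivity)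
  have h16 : (1 : ℝ) ≤ (1 + Real.log x) ^ 16 := one_le_pow₀ (by linarith)
  have hx1e : 0 ≤ x ^ (1 - ε) := (Real.rpow_pos_of_pos hx0 _).le
  calc deltaStar a z M N L Q R
      ≤ L * M * (Q * R + C * (1 + Real.log Q) ^ 8 * (1 + Real.log R) ^ 8) :=
        h z hz a M N L Q R hM hL hQ hR
    _ ≤ x ^ (1 - ε) / (Q * R) * (Q * R + C * (1 + Real.log x) ^ 16) := by
        refine mul_le_mul hLM' ?_ (by positivity) (by positivity)
        rw [mul_assoc]
        exact add_le_add le_rfl (mul_le_mul_of_nonneg_left hlogs hC.le)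
    _ = x ^ (1 - ε) * (1 + C * (1 + Real.log x) ^ 16 / (Q * R)) := by
        field_simp
    _ ≤ x ^ (1 - ε) * (1 * (1 + Real.log x) ^ 16 + C * (1 + Real.log x) ^ 16) := by
        refine mul_le_mul_of_nonneg_left (add_le_add (by linarith) ?_) hx1e
        exact div_le_self (by positivity) hQR
    _ = (1 + C) * x ^ (1 - ε) * (1 + Real.log x) ^ 16 := by ring

/-! ### The numerics of p. 246: `𝓘` and the final bound under (14.4)–(14.6)

After Poisson summation and separation of variables, §14 bounds `Δ₀` by
`M (QR)⁻¹ 𝒦(N, Q, a²H, R, |a|L) + x^{1−ε}` with `H = x^ε QR/M`, and Lemma 1 gives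
`𝒦 ≪ x^ε 𝓘 ‖B‖`, `‖B‖² ≪ HLR`, where `𝓘 = 𝓘(N, Q, a²H, R, |a|L)` is the quantity of Lemma 1
(`BFI.lemma1I`).  The two displays "Then `H < x^ε LR`, so `𝓘 ≪ x^ε (QRLN)^{1/2}(LR + NL^{1/2})^{1/2}`"
and "`Δ₀ ≪ x^ε M(QR)⁻¹ (QRLN)^{1/2} (LR + NL^{1/2})^{1/2} (QR²L/M)^{1/2} + x^{1−ε} ≪ x^{1−ε}` provided
(14.5), (14.6)" are the following real inequalities (the powers `x^ε` are carried as parameters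
`T, U ≥ 1`). -/

/-- **`H < x^ε LR` under (14.4)** (p. 246): if `N ≤ U·QR` and `Q²R ≤ x = LMN` then
`QR/M ≤ U·LR`, hence `H = T·QR/M ≤ T U · LR`. [cite: BombieriFriedlanderIwaniecActa1986, §14 (14.4) p. 246] -/
theorem section14_H_le {L M N Q R T U x : ℝ} (hL : 0 < L) (hM : 0 < M) (hN : 0 < N) (hQ : 0 ≤ Q)
    (hR : 0 ≤ R) (hT : 0 ≤ T) (hU : 0 ≤ U) (hx : L * M * N = x) (hNU : N ≤ U * (Q * R))
    (hQ2R : Q ^ 2 * R ≤ x) :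
    T * (Q * R) / M ≤ T * U * (L * R) := by
  have hx0 : 0 < x := by rw [← hx]; positivity
  -- `QR/M = QRLN/x ≤ QRL·UQR/x = U L (Q²R) R / x ≤ U L R`
  have h1 : Q * R / M = Q * R * (L * N) / x := by
    rw [← hx]; field_simp
  have h2 : Q * R * (L * N) ≤ U * (L * R) * x := by
    calc Q * R * (L * N) ≤ Q * R * (L * (U * (Q * R))) := by gcongr
      _ = U * (L * R) * (Q ^ 2 * R) := by ring
      _ ≤ U * (L * R) * x := by gcongr
  have key : Q * R / M ≤ U * (L * R) := by
    rw [h1, div_le_iff₀ hx0]; exact h2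
  calc T * (Q * R) / M = T * (Q * R / M) := by ring
    _ ≤ T * (U * (L * R)) := mul_le_mul_of_nonneg_left key hT
    _ = T * U * (L * R) := by ring

/-- **`𝓘² ≪ x^ε QRLN (LR + NL^{1/2})` under (14.4)** (p. 246, with the dependence on `a` explicit):
for `a' ≥ 1` (`= |a|`), `L, M, N, Q, R ≥ 1`, `T, U ≥ 1`, `x = LMN`, `H = T·QR/M`, `N ≤ U·QR` and
`Q²R ≤ x`,
`𝓘(N, Q, a'²H, R, a'L)² ≤ 7 a'³ T U² · QRLN (LR + N L^{1/2})`.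
The three terms of `𝓘²` are `≤ 4a'³TU² QRLN·LR`, `≤ 2 a'³ T U² QRLN·NL^{1/2}` and
`≤ a'T QRLN·LR · Q²/(L²x) ≤ a'³TU² QRLN·LR`. [cite: BombieriFriedlanderIwaniecActa1986, §14 p. 246; §2 Lemma 1 p. 210] -/
theorem lemma1I_sq_le_section14 {a' L M N Q R T U x H : ℝ} (ha : 1 ≤ a') (hL : 1 ≤ L) (hM : 1 ≤ M)
    (hN : 1 ≤ N) (hQ : 1 ≤ Q) (hR : 1 ≤ R) (hT : 1 ≤ T) (hU : 1 ≤ U) (hx : L * M * N = x)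
    (hH : H = T * (Q * R) / M) (hNU : N ≤ U * (Q * R)) (hQ2R : Q ^ 2 * R ≤ x) :
    lemma1I N Q (a' ^ 2 * H) R (a' * L) ^ 2 ≤
      7 * a' ^ 3 * T * U ^ 2 * (Q * R * L * N * (L * R + N * L ^ (1 / 2 : ℝ))) := by
  have ha0 : a' ≠ 0 := by positivity
  have hL0 : L ≠ 0 := by positivity
  have hM0 : M ≠ 0 := by positivity
  have hN0 : N ≠ 0 := by positivity
  have hx0 : 0 < x := by rw [← hx]; positivity
  have hH0 : 0 ≤ H := by rw [hH]; positivity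
  have hHle : H ≤ T * U * (L * R) := by
    rw [hH]
    exact section14_H_le (by linarith) (by linarith) (by linarith) (by linarith) (by linarith)
      (by linarith) (by linarith) hx hNU hQ2R
  have hTU : 1 ≤ T * U := one_le_mul_of_one_le_of_one_le hT hU
  have hLR : 1 ≤ L * R := one_le_mul_of_one_le_of_one_le hL hR
  have ha3 : a' ≤ a' ^ 3 := le_self_pow₀ ha (by norm_num)
  have ha23 : a' ^ 2 ≤ a' ^ 3 := pow_le_pow_right₀ ha (by norm_num)
  have hU2 : U ≤ U ^ 2 := le_self_pow₀ hU (by norm_num)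
  have hU21 : (1 : ℝ) ≤ U ^ 2 := one_le_pow₀ hU
  -- the two blocks `X_A = QRLN·LR`, `X_B = QRLN·NL^{1/2}`
  set XA : ℝ := Q * R * L * N * (L * R) with hXA
  set XB : ℝ := Q * R * L * N * (N * L ^ (1 / 2 : ℝ)) with hXB
  have hXA0 : 0 ≤ XA := by positivity
  have hXB0 : 0 ≤ XB := by positivity
  -- `RS + N' ≤ 2 a'² T U · LR` and `C + DR ≤ 2U · QR`
  have hRS : R * (a' * L) + a' ^ 2 * H ≤ 2 * a' ^ 2 * (T * U) * (L * R) := by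
    have h1 : R * (a' * L) ≤ a' ^ 2 * (T * U) * (L * R) := by
      calc R * (a' * L) = a' * 1 * (L * R) := by ring
        _ ≤ (a' * a' * (T * U)) * (L * R) := by
            refine mul_le_mul_of_nonneg_right ?_ (by positivity)
            calc a' * 1 ≤ a' * a' := mul_le_mul_of_nonneg_left ha (by linarith)
              _ = a' * a' * 1 := (mul_one _).symm
              _ ≤ a' * a' * (T * U) := mul_le_mul_of_nonneg_left hTU (by positivity)
        _ = a' ^ 2 * (T * U) * (L * R) := by ring
    have h2 : a' ^ 2 * H ≤ a' ^ 2 * (T * U) * (L * R) := by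
      rw [mul_assoc]; exact mul_le_mul_of_nonneg_left hHle (by positivity)
    linarith
  have hCDR : N + Q * R ≤ 2 * U * (Q * R) := by
    have : Q * R ≤ U * (Q * R) := le_mul_of_one_le_left (by positivity) hU
    linarith
  have hRS0 : 0 ≤ R * (a' * L) + a' ^ 2 * H := by positivity
  -- the square root: `√((RS+N')R) ≤ 2 a' (TU) R L^{1/2}`
  have hL12 : (L ^ (1 / 2 : ℝ)) ^ 2 = L := by
    rw [← Real.rpow_natCast, ← Real.rpow_mul (by linarith)]; norm_num
  have hsqrt : Real.sqrt ((R * (a' * L) + a' ^ 2 * H) * R) ≤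
      2 * a' * (T * U) * R * L ^ (1 / 2 : ℝ) := by
    have hbound : (R * (a' * L) + a' ^ 2 * H) * R ≤ (2 * a' * (T * U) * R * L ^ (1 / 2 : ℝ)) ^ 2 := by
      calc (R * (a' * L) + a' ^ 2 * H) * R ≤ 2 * a' ^ 2 * (T * U) * (L * R) * R :=
            mul_le_mul_of_nonneg_right hRS (by linarith)
        _ ≤ 2 * a' ^ 2 * (T * U) * (L * R) * R * (2 * (T * U)) :=
            le_mul_of_one_le_right (by positivity) (by linarith)
        _ = (2 * a' * (T * U) * R * L ^ (1 / 2 : ℝ)) ^ 2 := by rw [mul_pow, hL12]; ring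
    calc Real.sqrt ((R * (a' * L) + a' ^ 2 * H) * R)
        ≤ Real.sqrt ((2 * a' * (T * U) * R * L ^ (1 / 2 : ℝ)) ^ 2) := Real.sqrt_le_sqrt hbound
      _ = 2 * a' * (T * U) * R * L ^ (1 / 2 : ℝ) := Real.sqrt_sq (by positivity)
  -- unfold `𝓘²`
  have hI0 : 0 ≤ N * (a' * L) * (R * (a' * L) + a' ^ 2 * H) * (N + Q * R) +
      N ^ 2 * Q * (a' * L) * Real.sqrt ((R * (a' * L) + a' ^ 2 * H) * R) +
      Q ^ 2 * (a' ^ 2 * H) * R / (a' * L) := by positivity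
  rw [lemma1I, Real.sq_sqrt hI0]
  -- term 1: `≤ 4 a'³ T U² X_A`
  have h1 : N * (a' * L) * (R * (a' * L) + a' ^ 2 * H) * (N + Q * R) ≤ 4 * a' ^ 3 * T * U ^ 2 * XA := by
    calc N * (a' * L) * (R * (a' * L) + a' ^ 2 * H) * (N + Q * R)
        ≤ N * (a' * L) * (2 * a' ^ 2 * (T * U) * (L * R)) * (2 * U * (Q * R)) :=
          mul_le_mul (mul_le_mul_of_nonneg_left hRS (by positivity)) hCDR (by positivity)
            (by positivity)
      _ = 4 * a' ^ 3 * T * U ^ 2 * XA := by rw [hXA]; ring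
  -- term 2: `≤ 2 a'² (TU) X_B ≤ 2 a'³ T U² X_B`
  have h2 : N ^ 2 * Q * (a' * L) * Real.sqrt ((R * (a' * L) + a' ^ 2 * H) * R) ≤
      2 * a' ^ 3 * T * U ^ 2 * XB := by
    calc N ^ 2 * Q * (a' * L) * Real.sqrt ((R * (a' * L) + a' ^ 2 * H) * R)
        ≤ N ^ 2 * Q * (a' * L) * (2 * a' * (T * U) * R * L ^ (1 / 2 : ℝ)) :=
          mul_le_mul_of_nonneg_left hsqrt (by positivity)
      _ = 2 * (a' ^ 2 * (T * U)) * XB := by rw [hXB]; ring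
      _ ≤ 2 * (a' ^ 3 * (T * U ^ 2)) * XB := by
          refine mul_le_mul_of_nonneg_right (mul_le_mul_of_nonneg_left ?_ (by norm_num)) hXB0
          exact mul_le_mul ha23 (mul_le_mul_of_nonneg_left hU2 (by linarith)) (by positivity)
            (by positivity)
      _ = 2 * a' ^ 3 * T * U ^ 2 * XB := by ring
  -- term 3: `Q² a'² H R/(a'L) = a' T · X_A · Q²/(L²x) ≤ a' T · X_A ≤ a'³ T U² X_A`
  have h3 : Q ^ 2 * (a' ^ 2 * H) * R / (a' * L) ≤ 1 * a' ^ 3 * T * U ^ 2 * XA := by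
    have hQ2 : Q ^ 2 ≤ L ^ 2 * x := by
      have hL2 : (1 : ℝ) ≤ L ^ 2 := one_le_pow₀ hL
      calc Q ^ 2 = Q ^ 2 * 1 := (mul_one _).symm
        _ ≤ Q ^ 2 * R := mul_le_mul_of_nonneg_left hR (by positivity)
        _ ≤ x := hQ2R
        _ = 1 * x := (one_mul _).symm
        _ ≤ L ^ 2 * x := mul_le_mul_of_nonneg_right hL2 hx0.le
    have heq : Q ^ 2 * (a' ^ 2 * H) * R / (a' * L) = a' * T * XA * (Q ^ 2 / (L ^ 2 * x)) := by
      rw [hH, hXA, ← hx]; field_simp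
    rw [heq]
    have hfrac : Q ^ 2 / (L ^ 2 * x) ≤ 1 := by
      rw [div_le_one (by positivity)]; exact hQ2
    calc a' * T * XA * (Q ^ 2 / (L ^ 2 * x))
        ≤ a' * T * XA * 1 := mul_le_mul_of_nonneg_left hfrac (by positivity)
      _ = a' * 1 * (T * XA) := by ring
      _ ≤ a' ^ 3 * U ^ 2 * (T * XA) :=
          mul_le_mul_of_nonneg_right (mul_le_mul ha3 hU21 (by norm_num) (by positivity))
            (by positivity)
      _ = 1 * a' ^ 3 * T * U ^ 2 * XA := by ring
  have hsplit : 7 * a' ^ 3 * T * U ^ 2 * (Q * R * L * N * (L * R + N * L ^ (1 / 2 : ℝ))) =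
      7 * (a' ^ 3 * T * U ^ 2) * XA + 7 * (a' ^ 3 * T * U ^ 2) * XB := by
    rw [hXA, hXB]; ring
  rw [hsplit]
  have hK0 : 0 ≤ a' ^ 3 * T * U ^ 2 := by positivity
  nlinarith [mul_nonneg hK0 hXA0, mul_nonneg hK0 hXB0]

/-- **The final numerics of Theorem 7** (p. 246: "`Δ₀ ≪ x^ε M(QR)⁻¹(QRLN)^{1/2}(LR + NL^{1/2})^{1/2}
(QR²L/M)^{1/2} + x^{1−ε} ≪ x^{1−ε}` provided (14.5) `LR < x^{1/2−ε}` and (14.6)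
`L^{1/2}R < Mx^{−ε}`"): with `x = LMN`, `L, N, R ≥ 1`, `x ≥ 1`, `ε ≥ 0`,
`x · LR · (LR + N L^{1/2}) ≤ 2 x^{2−ε}` — indeed `x (LR)² < x^{2−2ε}` by (14.5) and
`x LR · NL^{1/2} = x (L^{1/2}R)(LN) = x² (L^{1/2}R/M) < x^{2−ε}` by (14.6); note
`(M/(QR))² · QRLN(LR + NL^{1/2}) · (T QR/M) LR = T · x LR (LR + NL^{1/2})` identically
(`section14_main_identity`). [cite: BombieriFriedlanderIwaniecActa1986, §14 (14.5)–(14.6) p. 246] -/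
theorem section14_final_numerics {L M N R x ε : ℝ} (hL : 1 ≤ L) (hN : 1 ≤ N)
    (hR : 1 ≤ R) (hx : L * M * N = x) (hx1 : 1 ≤ x) (hε : 0 ≤ ε)
    (h5 : L * R < x ^ (1 / 2 - ε)) (h6 : L ^ (1 / 2 : ℝ) * R < M * x ^ (-ε)) :
    x * (L * R) * (L * R + N * L ^ (1 / 2 : ℝ)) ≤ 2 * x ^ (2 - ε) := by
  have hx0 : 0 < x := by linarith
  have hLR0 : 0 ≤ L * R := by positivity
  -- (14.5): `x (LR)² ≤ x · x^{1−2ε} = x^{2−2ε} ≤ x^{2−ε}`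
  have hA : x * (L * R) * (L * R) ≤ x ^ (2 - ε) := by
    have hsq : (L * R) * (L * R) ≤ x ^ (1 / 2 - ε) * x ^ (1 / 2 - ε) :=
      mul_le_mul h5.le h5.le hLR0 (Real.rpow_nonneg hx0.le _)
    calc x * (L * R) * (L * R) = x * ((L * R) * (L * R)) := by ring
      _ ≤ x * (x ^ (1 / 2 - ε) * x ^ (1 / 2 - ε)) := mul_le_mul_of_nonneg_left hsq hx0.le
      _ = x ^ (1 : ℝ) * x ^ (1 / 2 - ε + (1 / 2 - ε)) := by rw [Real.rpow_one, Real.rpow_add hx0]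
      _ = x ^ (2 - 2 * ε) := by
          rw [← Real.rpow_add hx0]
          congr 1
          ring
      _ ≤ x ^ (2 - ε) := Real.rpow_le_rpow_of_exponent_le hx1 (by linarith)
  -- (14.6): `x LR · N L^{1/2} = x (L^{1/2} R) (LN) ≤ x (M x^{−ε}) (LN) = x^{2−ε}`
  have hB : x * (L * R) * (N * L ^ (1 / 2 : ℝ)) ≤ x ^ (2 - ε) := by
    have heq : x * (L * R) * (N * L ^ (1 / 2 : ℝ)) = x * (L ^ (1 / 2 : ℝ) * R) * (L * N) := by ring
    rw [heq]
    calc x * (L ^ (1 / 2 : ℝ) * R) * (L * N)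
        ≤ x * (M * x ^ (-ε)) * (L * N) :=
          mul_le_mul_of_nonneg_right (mul_le_mul_of_nonneg_left h6.le hx0.le) (by positivity)
      _ = x * x ^ (-ε) * (L * M * N) := by ring
      _ = x ^ (1 : ℝ) * x ^ (-ε) * x ^ (1 : ℝ) := by rw [hx, Real.rpow_one]
      _ = x ^ (2 - ε) := by
          rw [← Real.rpow_add hx0, ← Real.rpow_add hx0]
          congr 1
          ring
  calc x * (L * R) * (L * R + N * L ^ (1 / 2 : ℝ))
      = x * (L * R) * (L * R) + x * (L * R) * (N * L ^ (1 / 2 : ℝ)) := by ring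
    _ ≤ x ^ (2 - ε) + x ^ (2 - ε) := add_le_add hA hB
    _ = 2 * x ^ (2 - ε) := by ring

/-- The algebraic identity behind the last display of p. 246:
`(M/(QR))² · QRLN (LR + NL^{1/2}) · ((T·QR/M) · L · R) = T · x · LR (LR + NL^{1/2})` for `x = LMN`
(`M, Q, R ≠ 0`). [cite: BombieriFriedlanderIwaniecActa1986, §14 p. 246] -/
theorem section14_main_identity {L M N Q R T x : ℝ} (hM : M ≠ 0) (hQ : Q ≠ 0) (hR : R ≠ 0)
    (hx : L * M * N = x) :
    (M / (Q * R)) ^ 2 * (Q * R * L * N * (L * R + N * L ^ (1 / 2 : ℝ))) * (T * (Q * R) / M * (L * R)) =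
      T * (x * (L * R) * (L * R + N * L ^ (1 / 2 : ℝ))) := by
  rw [← hx]
  field_simp

/-- **Step 5 of the proof of Theorem 7, assembled** (p. 246): under (14.4)–(14.6), with `H = T·QR/M`,
`M (QR)⁻¹ · 𝓘(N, Q, a'²H, R, a'L) · (H L R)^{1/2} ≤ (14 a'³ T²)^{1/2} · U · x^{1−ε/2}`.
(The left side is the shape of the bound `M(QR)⁻¹ 𝒦` after Lemma 1 with `‖B‖ ≤ (HLR)^{1/2}`; the
factors `T = x^{ε₁}`, `U = x^{ε₂}` and Lemma 1's own `(CDNRS)^ε` are the floating `x^ε` of the print.)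
[cite: BombieriFriedlanderIwaniecActa1986, §14 p. 246] -/
theorem section14_step5 {a' L M N Q R T U x H ε : ℝ} (ha : 1 ≤ a') (hL : 1 ≤ L) (hM : 1 ≤ M)
    (hN : 1 ≤ N) (hQ : 1 ≤ Q) (hR : 1 ≤ R) (hT : 1 ≤ T) (hU : 1 ≤ U) (hx : L * M * N = x)
    (hH : H = T * (Q * R) / M) (hNU : N ≤ U * (Q * R)) (hQ2R : Q ^ 2 * R ≤ x) (hε : 0 ≤ ε)
    (h5 : L * R < x ^ (1 / 2 - ε)) (h6 : L ^ (1 / 2 : ℝ) * R < M * x ^ (-ε)) :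
    M / (Q * R) * lemma1I N Q (a' ^ 2 * H) R (a' * L) * Real.sqrt (H * (L * R)) ≤
      Real.sqrt (14 * a' ^ 3 * T ^ 2) * U * x ^ (1 - ε / 2) := by
  have hx1 : 1 ≤ x := by
    rw [← hx]
    exact one_le_mul_of_one_le_of_one_le (one_le_mul_of_one_le_of_one_le hL hM) hN
  have hx0 : 0 < x := by linarith
  have hH0 : 0 ≤ H := by rw [hH]; positivity
  have hI0 : 0 ≤ lemma1I N Q (a' ^ 2 * H) R (a' * L) := Real.sqrt_nonneg _
  have hlhs0 : 0 ≤ M / (Q * R) * lemma1I N Q (a' ^ 2 * H) R (a' * L) * Real.sqrt (H * (L * R)) := by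
    positivity
  have hrhs0 : 0 ≤ Real.sqrt (14 * a' ^ 3 * T ^ 2) * U * x ^ (1 - ε / 2) := by positivity
  -- compare squares
  rw [← abs_of_nonneg hlhs0, ← abs_of_nonneg hrhs0, ← sq_le_sq]
  have hI2 := lemma1I_sq_le_section14 ha hL hM hN hQ hR hT hU hx hH hNU hQ2R
  have hnum := section14_final_numerics hL hN hR hx hx1 hε h5 h6
  have hM0 : M ≠ 0 := by positivity
  have hQ0 : Q ≠ 0 := by positivity
  have hR0 : R ≠ 0 := by positivity
  have hid := section14_main_identity (L := L) (N := N) (T := T) hM0 hQ0 hR0 hx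
  have hx2e : (x ^ (1 - ε / 2)) ^ 2 = x ^ (2 - ε) := by
    rw [← Real.rpow_natCast, ← Real.rpow_mul hx0.le]; congr 1; push_cast; ring
  have h14 : Real.sqrt (14 * a' ^ 3 * T ^ 2) ^ 2 = 14 * a' ^ 3 * T ^ 2 := Real.sq_sqrt (by positivity)
  have hHLR : Real.sqrt (H * (L * R)) ^ 2 = H * (L * R) := Real.sq_sqrt (by positivity)
  calc (M / (Q * R) * lemma1I N Q (a' ^ 2 * H) R (a' * L) * Real.sqrt (H * (L * R))) ^ 2
      = (M / (Q * R)) ^ 2 * lemma1I N Q (a' ^ 2 * H) R (a' * L) ^ 2 * (H * (L * R)) := by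
        rw [mul_pow, mul_pow, hHLR]
    _ ≤ (M / (Q * R)) ^ 2 * (7 * a' ^ 3 * T * U ^ 2 * (Q * R * L * N * (L * R + N * L ^ (1 / 2 : ℝ)))) *
          (H * (L * R)) :=
        mul_le_mul_of_nonneg_right (mul_le_mul_of_nonneg_left hI2 (by positivity)) (by positivity)
    _ = 7 * a' ^ 3 * T * U ^ 2 *
          ((M / (Q * R)) ^ 2 * (Q * R * L * N * (L * R + N * L ^ (1 / 2 : ℝ))) *
            (T * (Q * R) / M * (L * R))) := by rw [hH]; ring
    _ = 7 * a' ^ 3 * T * U ^ 2 * (T * (x * (L * R) * (L * R + N * L ^ (1 / 2 : ℝ)))) := by rw [hid]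
    _ ≤ 7 * a' ^ 3 * T * U ^ 2 * (T * (2 * x ^ (2 - ε))) := by
        refine mul_le_mul_of_nonneg_left (mul_le_mul_of_nonneg_left hnum (by linarith)) (by positivity)
    _ = (Real.sqrt (14 * a' ^ 3 * T ^ 2) * U * x ^ (1 - ε / 2)) ^ 2 := by
        rw [mul_pow, mul_pow, h14, hx2e]; ring

/-! ### Merging the variable `n` into `l` (for the sieve extension with a short `n`)

In the extension `Δ → Δ*` by the fundamental lemma (p. 246, "as in Section 12, using Lemma 4"),
only a variable that is long compared with the sieve level can be sieved with an admissible
remainder.  A short `z`-rough variable `n` is instead absorbed into `l`: for each fixed rough `n`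
the map `l ↦ ln` is injective, `(ln, r) = 1` and `(q, a·ln) = 1` are exactly the side conditions of
`Δ*` at `l' = ln`, and the bracket at `(l, qr)` restricted to this `n` is the bracket of
`Δ*(M, 1, ·, Q, R)` at `l' = ln` (for `(n, qr) > 1` both vanish).  Hence
`Δ*(M, N, L, Q, R) ≤ ∑_{n ≤ N} 1_{(n,P(z))=1} Δ*(M, 1, Ln, Q, R)` (`deltaStar_le_sum_deltaStar_one`). -/

/-- `1` is `z`-rough for every `z`. [folklore] -/
theorem roughIndicator_one (z : ℝ) : roughIndicator z 1 = 1 := by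
  unfold roughIndicator
  rw [if_pos]
  intro p hp
  simp at hp

/-- `roughIndicator z` is completely multiplicative on positive integers (an integer is free of
prime factors `< z` iff both factors are). [folklore] -/
theorem roughIndicator_mul {l n : ℕ} (hl : l ≠ 0) (hn : n ≠ 0) (z : ℝ) :
    roughIndicator z (l * n) = roughIndicator z l * roughIndicator z n := by
  have hpf : (l * n).primeFactors = l.primeFactors ∪ n.primeFactors := Nat.primeFactors_mul hl hn
  unfold roughIndicator
  by_cases h1 : ∀ p ∈ l.primeFactors, z ≤ (p : ℝ)
  · by_cases h2 : ∀ p ∈ n.primeFactors, z ≤ (p : ℝ)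
    · have h12 : ∀ p ∈ (l * n).primeFactors, z ≤ (p : ℝ) := by
        intro p hp
        rw [hpf, Finset.mem_union] at hp
        exact hp.elim (h1 p) (h2 p)
      rw [if_pos h1, if_pos h2, if_pos h12, one_mul]
    · have h12 : ¬ ∀ p ∈ (l * n).primeFactors, z ≤ (p : ℝ) := fun h =>
        h2 fun p hp => h p (by rw [hpf, Finset.mem_union]; exact Or.inr hp)
      rw [if_pos h1, if_neg h2, if_neg h12, one_mul]
  · have h12 : ¬ ∀ p ∈ (l * n).primeFactors, z ≤ (p : ℝ) := fun h =>
      h1 fun p hp => h p (by rw [hpf, Finset.mem_union]; exact Or.inl hp)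
    rw [if_neg h1, if_neg h12, zero_mul]

/-- `roughIndicator z n ∈ {0, 1}` is idempotent. [folklore] -/
theorem roughIndicator_mul_self (z : ℝ) (n : ℕ) :
    roughIndicator z n * roughIndicator z n = roughIndicator z n := by
  unfold roughIndicator; split_ifs <;> norm_num

/-- The congruence count with `N = 1`: `∑_{m ≤ M, lm ≡ a (d)} 1_{rough}(m)`. [folklore] -/
theorem roughCongrCount_one (a : ℤ) (z M : ℝ) (l d : ℕ) :
    roughCongrCount a z M 1 l d =
      ∑ m ∈ Icc 1 ⌊M⌋₊, if ((l * m : ℕ) : ZMod d) = (a : ZMod d) then roughIndicator z m else 0 := by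
  unfold roughCongrCount
  rw [Nat.floor_one, Finset.Icc_self]
  refine Finset.sum_congr rfl fun m _ => ?_
  rw [Finset.sum_singleton, mul_one, roughIndicator_one, mul_one]

/-- The coprimality count with `N = 1`: `∑_{m ≤ M, (m, d) = 1} 1_{rough}(m)`. [folklore] -/
theorem roughCoprimeCount_one (z M : ℝ) (d : ℕ) :
    roughCoprimeCount z M 1 d =
      ∑ m ∈ Icc 1 ⌊M⌋₊, if m.Coprime d then roughIndicator z m else 0 := by
  unfold roughCoprimeCount
  rw [Nat.floor_one, Finset.Icc_self]
  refine Finset.sum_congr rfl fun m _ => ?_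
  rw [Finset.sum_singleton, mul_one, roughIndicator_one, mul_one]

/-- **The bracket of `Δ*` decomposes over `n`.**  For `(d, a) = 1`:
`T(l, d) := #*{lmn ≡ a (d)} − φ(d)⁻¹ #*{(mn, d) = 1}
 = ∑_{n ≤ N} 1_{rough}(n) · 1_{(n,d)=1} · ( #*{m : (ln)m ≡ a (d)} − φ(d)⁻¹ #*{m : (m, d) = 1} )`,
the terms with `(n, d) > 1` contributing nothing to either count. [folklore] -/
theorem roughBracket_eq_sum_n (a : ℤ) (z M N : ℝ) (l : ℕ) {d : ℕ} (hda : IsCoprime (d : ℤ) a) :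
    roughCongrCount a z M N l d - roughCoprimeCount z M N d / (Nat.totient d : ℝ) =
      ∑ n ∈ Icc 1 ⌊N⌋₊, roughIndicator z n *
        (if n.Coprime d then
          roughCongrCount a z M 1 (l * n) d - roughCoprimeCount z M 1 d / (Nat.totient d : ℝ)
        else 0) := by
  -- the congruence count
  have hA : roughCongrCount a z M N l d =
      ∑ n ∈ Icc 1 ⌊N⌋₊, roughIndicator z n *
        (if n.Coprime d then roughCongrCount a z M 1 (l * n) d else 0) := by
    conv_lhs => unfold roughCongrCount
    rw [Finset.sum_comm]
    refine Finset.sum_congr rfl fun n _ => ?_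
    rw [roughCongrCount_one]
    by_cases hn : n.Coprime d
    · rw [if_pos hn, Finset.mul_sum]
      refine Finset.sum_congr rfl fun m _ => ?_
      rw [mul_right_comm l m n]
      split_ifs <;> ring
    · rw [if_neg hn, mul_zero]
      refine Finset.sum_eq_zero fun m _ => ?_
      rw [if_neg]
      intro h
      have hc : d.Coprime (l * m * n) := by
        have h' : ((l * m * n * 1 : ℕ) : ZMod d) = (a : ZMod d) := by rwa [mul_one]
        exact coprime_of_natCast_mul_eq hda (m := l * m * n) (n := 1) h'
      exact hn (Nat.Coprime.coprime_mul_left_right hc).symm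
  -- the coprimality count
  have hB : roughCoprimeCount z M N d =
      ∑ n ∈ Icc 1 ⌊N⌋₊, roughIndicator z n *
        (if n.Coprime d then roughCoprimeCount z M 1 d else 0) := by
    conv_lhs => unfold roughCoprimeCount
    rw [Finset.sum_comm]
    refine Finset.sum_congr rfl fun n _ => ?_
    rw [roughCoprimeCount_one]
    by_cases hn : n.Coprime d
    · rw [if_pos hn, Finset.mul_sum]
      refine Finset.sum_congr rfl fun m _ => ?_
      by_cases hm : m.Coprime d
      · rw [if_pos (Nat.Coprime.mul_left hm hn), if_pos hm]; ring
      · rw [if_neg (fun h => hm (Nat.Coprime.coprime_mul_right h)), if_neg hm]; ring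
    · rw [if_neg hn, mul_zero]
      refine Finset.sum_eq_zero fun m _ => ?_
      rw [if_neg (fun h => hn (Nat.Coprime.coprime_mul_left h))]
  rw [hA, hB, Finset.sum_div, ← Finset.sum_sub_distrib]
  refine Finset.sum_congr rfl fun n _ => ?_
  split_ifs <;> ring

/-- **Merging `n` into `l`**: `Δ*(M, N, L, Q, R) ≤ ∑_{n ≤ N} 1_{(n,P(z))=1} Δ*(M, 1, Ln, Q, R)`
(all `a, z`, and `M, N, L, Q, R` real).  See the section docstring.
[cite: BombieriFriedlanderIwaniecActa1986, §14 p. 246 ("we can extend the result to sums `Δ*`")] -/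
theorem deltaStar_le_sum_deltaStar_one (a : ℤ) (z M N L Q R : ℝ) :
    deltaStar a z M N L Q R ≤
      ∑ n ∈ Icc 1 ⌊N⌋₊, roughIndicator z n * deltaStar a z M 1 (L * n) Q R := by
  classical
  -- notation: the `q`-sum of the `N = 1` brackets at `l'`, for the modulus factor `r`
  set S : ℕ → ℕ → ℝ := fun r l' =>
    ∑ q ∈ (Icc 1 ⌊Q⌋₊).filter (fun q : ℕ => IsCoprime (q : ℤ) (a * l')),
      (roughCongrCount a z M 1 l' (q * r) - roughCoprimeCount z M 1 (q * r) / (Nat.totient (q * r) : ℝ))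
    with hS
  have hrn : ∀ n, 0 ≤ roughIndicator z n := roughIndicator_nonneg z
  -- Step 1–3: for admissible `r, l`, `|∑_q T(l, qr)| ≤ ∑_n 1_rough(n) 1_{(n,r)=1} |S r (l n)|`
  have hkey : ∀ r ∈ (Icc 1 ⌊R⌋₊).filter (fun r : ℕ => IsCoprime (r : ℤ) a),
      ∀ l ∈ (Icc 1 ⌊L⌋₊).filter (fun l : ℕ => l.Coprime r),
        |∑ q ∈ (Icc 1 ⌊Q⌋₊).filter (fun q : ℕ => IsCoprime (q : ℤ) (a * l)),
          (roughCongrCount a z M N l (q * r) -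
            roughCoprimeCount z M N (q * r) / (Nat.totient (q * r) : ℝ))| ≤
        ∑ n ∈ Icc 1 ⌊N⌋₊, roughIndicator z n * (if n.Coprime r then |S r (l * n)| else 0) := by
    intro r hr l hl
    rw [Finset.mem_filter, Finset.mem_Icc] at hr hl
    -- rewrite every bracket through `roughBracket_eq_sum_n` and swap the sums
    have h1 : ∑ q ∈ (Icc 1 ⌊Q⌋₊).filter (fun q : ℕ => IsCoprime (q : ℤ) (a * l)),
        (roughCongrCount a z M N l (q * r) -
          roughCoprimeCount z M N (q * r) / (Nat.totient (q * r) : ℝ)) =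
        ∑ n ∈ Icc 1 ⌊N⌋₊, roughIndicator z n *
          ∑ q ∈ (Icc 1 ⌊Q⌋₊).filter (fun q : ℕ => IsCoprime (q : ℤ) (a * l)),
            (if n.Coprime (q * r) then
              roughCongrCount a z M 1 (l * n) (q * r) -
                roughCoprimeCount z M 1 (q * r) / (Nat.totient (q * r) : ℝ)
            else 0) := by
      have : ∀ q ∈ (Icc 1 ⌊Q⌋₊).filter (fun q : ℕ => IsCoprime (q : ℤ) (a * l)),
          roughCongrCount a z M N l (q * r) -
            roughCoprimeCount z M N (q * r) / (Nat.totient (q * r) : ℝ) =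
          ∑ n ∈ Icc 1 ⌊N⌋₊, roughIndicator z n *
            (if n.Coprime (q * r) then
              roughCongrCount a z M 1 (l * n) (q * r) -
                roughCoprimeCount z M 1 (q * r) / (Nat.totient (q * r) : ℝ)
            else 0) := by
        intro q hq
        rw [Finset.mem_filter, Finset.mem_Icc] at hq
        have hda : IsCoprime ((q * r : ℕ) : ℤ) a := by
          push_cast
          exact IsCoprime.mul_left hq.2.of_mul_right_left hr.2
        exact roughBracket_eq_sum_n a z M N l hda
      rw [Finset.sum_congr rfl this, Finset.sum_comm]
      refine Finset.sum_congr rfl fun n _ => ?_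
      rw [Finset.mul_sum]
    rw [h1]
    refine (Finset.abs_sum_le_sum_abs _ _).trans (Finset.sum_le_sum fun n hn => ?_)
    rw [Finset.mem_Icc] at hn
    rw [abs_mul, abs_of_nonneg (hrn n)]
    refine mul_le_mul_of_nonneg_left ?_ (hrn n)
    by_cases hnr : n.Coprime r
    · rw [if_pos hnr, hS]
      -- the `q`-sets agree
      refine le_of_eq (congrArg _ ?_)
      rw [← Finset.sum_filter]
      refine Finset.sum_congr ?_ fun q _ => rfl
      ext q
      simp only [Finset.mem_filter, Finset.mem_Icc]
      constructor
      · rintro ⟨⟨hq, hqal⟩, hnqr⟩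
        refine ⟨hq, ?_⟩
        rw [Nat.cast_mul, ← mul_assoc]
        exact IsCoprime.mul_right hqal
          (Nat.isCoprime_iff_coprime.mpr (Nat.Coprime.coprime_mul_right_right hnqr).symm)
      · rintro ⟨hq, hqaln⟩
        rw [Nat.cast_mul, ← mul_assoc] at hqaln
        refine ⟨⟨hq, hqaln.of_mul_right_left⟩, ?_⟩
        exact Nat.Coprime.mul_right
          (Nat.isCoprime_iff_coprime.mp hqaln.of_mul_right_right).symm hnr
    · rw [if_neg hnr]
      refine le_of_eq ?_
      rw [abs_eq_zero]
      refine Finset.sum_eq_zero fun q _ => ?_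
      rw [if_neg (fun h => hnr (Nat.Coprime.coprime_mul_left_right h))]
  -- Step 4: per `n` and `r`, the `l`-sum is dominated by the `l'`-sum of `Δ*(M, 1, Ln, Q, R)`
  have hstep : ∀ n ∈ Icc 1 ⌊N⌋₊, ∀ r ∈ (Icc 1 ⌊R⌋₊).filter (fun r : ℕ => IsCoprime (r : ℤ) a),
      ∑ l ∈ (Icc 1 ⌊L⌋₊).filter (fun l : ℕ => l.Coprime r),
        roughIndicator z l * (roughIndicator z n * (if n.Coprime r then |S r (l * n)| else 0)) ≤
      roughIndicator z n *
        ∑ l' ∈ (Icc 1 ⌊L * n⌋₊).filter (fun l' : ℕ => l'.Coprime r),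
          roughIndicator z l' * |S r l'| := by
    intro n hn r hr
    rw [Finset.mem_Icc] at hn
    have hn0 : n ≠ 0 := by omega
    by_cases hnr : n.Coprime r
    · simp only [if_pos hnr]
      -- `rough l · rough n · |S (ln)| = rough n · (rough (ln) · |S (ln)|)`
      have hterm : ∀ l ∈ (Icc 1 ⌊L⌋₊).filter (fun l : ℕ => l.Coprime r),
          roughIndicator z l * (roughIndicator z n * |S r (l * n)|) =
            roughIndicator z n * (roughIndicator z (l * n) * |S r (l * n)|) := by
        intro l hl
        rw [Finset.mem_filter, Finset.mem_Icc] at hl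
        have hl0 : l ≠ 0 := by omega
        rw [roughIndicator_mul hl0 hn0]
        calc roughIndicator z l * (roughIndicator z n * |S r (l * n)|)
            = roughIndicator z l * ((roughIndicator z n * roughIndicator z n) * |S r (l * n)|) := by
              rw [roughIndicator_mul_self]
          _ = roughIndicator z n * (roughIndicator z l * roughIndicator z n * |S r (l * n)|) := by ring
      rw [Finset.sum_congr rfl hterm, ← Finset.mul_sum]
      refine mul_le_mul_of_nonneg_left ?_ (hrn n)
      -- reindex `l ↦ l n` and enlarge the range
      have hinj : Set.InjOn (fun l : ℕ => l * n) ((Icc 1 ⌊L⌋₊).filter (fun l : ℕ => l.Coprime r)) :=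
        fun l₁ _ l₂ _ h => Nat.eq_of_mul_eq_mul_right (Nat.pos_of_ne_zero hn0) h
      rw [← Finset.sum_image (f := fun l' => roughIndicator z l' * |S r l'|) hinj]
      refine Finset.sum_le_sum_of_subset_of_nonneg ?_ fun l' _ _ =>
        mul_nonneg (hrn l') (abs_nonneg _)
      intro l' hl'
      rw [Finset.mem_image] at hl'
      obtain ⟨l, hl, rfl⟩ := hl'
      rw [Finset.mem_filter, Finset.mem_Icc] at hl ⊢
      have hL1 : (1 : ℝ) ≤ L := by
        have : 0 < ⌊L⌋₊ := by omega
        exact Nat.floor_pos.mp this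
      refine ⟨⟨?_, ?_⟩, Nat.Coprime.mul_left hl.2 hnr⟩
      · exact Nat.mul_pos (by omega) (Nat.pos_of_ne_zero hn0)
      · refine Nat.le_floor ?_
        push_cast
        refine mul_le_mul_of_nonneg_right ?_ (Nat.cast_nonneg n)
        exact (Nat.cast_le.2 hl.1.2).trans (Nat.floor_le (by linarith))
    · simp only [if_neg hnr, mul_zero, Finset.sum_const_zero]
      exact mul_nonneg (hrn n) (Finset.sum_nonneg fun l' _ => mul_nonneg (hrn l') (abs_nonneg _))
  -- assemble
  unfold deltaStar
  calc _ ≤ ∑ r ∈ (Icc 1 ⌊R⌋₊).filter (fun r : ℕ => IsCoprime (r : ℤ) a),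
          ∑ l ∈ (Icc 1 ⌊L⌋₊).filter (fun l : ℕ => l.Coprime r),
            roughIndicator z l *
              ∑ n ∈ Icc 1 ⌊N⌋₊, roughIndicator z n * (if n.Coprime r then |S r (l * n)| else 0) :=
        Finset.sum_le_sum fun r hr => Finset.sum_le_sum fun l hl =>
          mul_le_mul_of_nonneg_left (hkey r hr l hl) (hrn l)
    _ = ∑ n ∈ Icc 1 ⌊N⌋₊, ∑ r ∈ (Icc 1 ⌊R⌋₊).filter (fun r : ℕ => IsCoprime (r : ℤ) a),
          ∑ l ∈ (Icc 1 ⌊L⌋₊).filter (fun l : ℕ => l.Coprime r),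
            roughIndicator z l * (roughIndicator z n * (if n.Coprime r then |S r (l * n)| else 0)) := by
        rw [Finset.sum_comm]
        refine Finset.sum_congr rfl fun r _ => ?_
        rw [Finset.sum_comm]
        refine Finset.sum_congr rfl fun l _ => ?_
        rw [Finset.mul_sum]
    _ ≤ ∑ n ∈ Icc 1 ⌊N⌋₊, ∑ r ∈ (Icc 1 ⌊R⌋₊).filter (fun r : ℕ => IsCoprime (r : ℤ) a),
          roughIndicator z n *
            ∑ l' ∈ (Icc 1 ⌊L * n⌋₊).filter (fun l' : ℕ => l'.Coprime r),
              roughIndicator z l' * |S r l'| :=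
        Finset.sum_le_sum fun n hn => Finset.sum_le_sum fun r hr => hstep n hn r hr
    _ = _ := by
        refine Finset.sum_congr rfl fun n _ => ?_
        rw [Finset.mul_sum]

end BFI

open BFI

/-! ### Reductions of the named fact -/

/-- **Theorem 7* reduces to the ordered case `N ≤ M`** (p. 246: "we assume that `N < M`"): if the
statement of `BombieriFriedlanderIwaniecTheorem7Star` holds under the extra hypothesis `N ≤ M`, it
holds as stated — for `M < N` exchange the two variables (`BFI.deltaStar_comm`); the hypotheses are
symmetric except (14.6), `L^{1/2} R < M x^{−ε}`, which only improves.
[cite: BombieriFriedlanderIwaniecActa1986, §14 p. 246] -/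
theorem BombieriFriedlanderIwaniecTheorem7Star.of_ordered
    (h : ∀ a : ℤ, a ≠ 0 → ∀ ε : ℝ, 0 < ε → ∀ A : ℝ, 0 < A →
      ∃ B C x₀ : ℝ, ∀ x : ℝ, x₀ ≤ x → ∀ M N L Q R : ℝ,
        1 ≤ M → 1 ≤ N → N ≤ M → 1 ≤ L → 1 ≤ Q → 1 ≤ R → L * M * N = x →
        Q * R < x / Real.log x ^ B →
        L * R < x ^ (1 / 2 - ε) →
        L ^ (1 / 2 : ℝ) * R < M * x ^ (-ε) →
        ∀ z : ℝ, z ≤ Real.exp (Real.log x / Real.log (Real.log x)) →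
          deltaStar a z M N L Q R ≤ C * x / Real.log x ^ A) :
    BombieriFriedlanderIwaniecTheorem7Star := by
  intro a ha ε hε A hA
  obtain ⟨B, C, x₀, hC⟩ := h a ha ε hε A hA
  refine ⟨B, C, max x₀ 1, fun x hx M N L Q R hM hN hL hQ hR hLMN hQR h5 h6 z hz => ?_⟩
  have hx₀ : x₀ ≤ x := (le_max_left _ _).trans hx
  have hx1 : 1 ≤ x := (le_max_right _ _).trans hx
  rcases le_total N M with hNM | hMN
  · exact hC x hx₀ M N L Q R hM hN hNM hL hQ hR hLMN hQR h5 h6 z hz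
  · rw [deltaStar_comm]
    refine hC x hx₀ N M L Q R hN hM hMN hL hQ hR (by rw [← hLMN]; ring) hQR h5 ?_ z hz
    have hxe : 0 ≤ x ^ (-ε) := (Real.rpow_pos_of_pos (by linarith) _).le
    exact h6.trans_le (mul_le_mul_of_nonneg_right hMN hxe)

/-- Unfolding `BombieriFriedlanderIwaniecTheorem7Star` at given `a, ε, A`, with the level exponent
and the constant normalised to be nonnegative and the threshold to be `≥ 3` (cosmetic: a larger `B`
shrinks the range `QR < x ℒ^{−B}` once `log x ≥ 1`; `x ≥ 3` makes `log log x > 0`). [folklore] -/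
theorem BombieriFriedlanderIwaniecTheorem7Star.bound_nonneg (h : BombieriFriedlanderIwaniecTheorem7Star)
    {a : ℤ} (ha : a ≠ 0) {ε : ℝ} (hε : 0 < ε) {A : ℝ} (hA : 0 < A) :
    ∃ B C x₀ : ℝ, 0 ≤ B ∧ 0 ≤ C ∧ 3 ≤ x₀ ∧ ∀ x : ℝ, x₀ ≤ x → ∀ M N L Q R : ℝ,
      1 ≤ M → 1 ≤ N → 1 ≤ L → 1 ≤ Q → 1 ≤ R → L * M * N = x →
      Q * R < x / Real.log x ^ B →
      L * R < x ^ (1 / 2 - ε) →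
      L ^ (1 / 2 : ℝ) * R < M * x ^ (-ε) →
      ∀ z : ℝ, z ≤ Real.exp (Real.log x / Real.log (Real.log x)) →
        deltaStar a z M N L Q R ≤ C * x / Real.log x ^ A := by
  obtain ⟨B, C, x₀, hC⟩ := h a ha ε hε A hA
  refine ⟨max B 0, max C 0, max x₀ 3, le_max_right _ _, le_max_right _ _, le_max_right _ _,
    fun x hx M N L Q R hM hN hL hQ hR hLMN hQR h5 h6 z hz => ?_⟩
  have hx₀ : x₀ ≤ x := (le_max_left _ _).trans hx
  have hx3 : 3 ≤ x := (le_max_right _ _).trans hx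
  have hxpos : 0 < x := by linarith
  have hlog : 1 ≤ Real.log x := by
    rw [← Real.log_exp 1]
    refine Real.log_le_log (Real.exp_pos 1) ?_
    have := Real.exp_one_lt_d9; norm_num at this; linarith
  -- the level `x / ℒ^{max B 0}` is at most `x / ℒ^B`
  have hQR' : Q * R < x / Real.log x ^ B := by
    refine hQR.trans_le ?_
    refine div_le_div_of_nonneg_left hxpos.le (Real.rpow_pos_of_pos (by linarith) _) ?_
    exact Real.rpow_le_rpow_of_exponent_le hlog (le_max_left _ _)
  refine (hC x hx₀ M N L Q R hM hN hL hQ hR hLMN hQR' h5 h6 z hz).trans ?_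
  have hlogpos : 0 < Real.log x := by linarith
  gcongr
  exact le_max_left _ _

end Literature.NumberTheory.Sieve
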